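import Mathlib
import HarnessLib
import Literature.MathematicalPhysics.StatisticalMechanics.TaylorPolynomialNorms

/-!
# Norms on Taylor polynomials relative to a gauge — II. Pull-back along a `T`-bounded linear map,
# duality bound, monotonicity in the gauge (Adams–Buchholz–Kotecký–Müller, App. A and Ch. 8.1)

Sequel of `TaylorPolynomialNorms.lean` (see there for the set-up: gauge map `T : E →ₗ[ℝ] V`,
lift `gaugeLift T F = F ∘ gaugeSection T` to the normed space `range T ≅ 𝒳/N_Φ`, and
`tayNorm T r₀ F φ = Σ_{s ≤ r₀} (s!)⁻¹ ‖D^s(gaugeLift T F)(Tφ)‖`, [ABKM19] Definition 13.7 with the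
tensor norm `ι = ∧`).  This file proves the estimate by which every concrete `T_φ` norm is computed
and two consequences:

* **`tayNorm_le_of_factor`** — if `F = f ∘ P` with `P : E →ₗ U` linear, `‖P ξ‖ ≤ c‖T ξ‖`, and
  `f ∈ C^{r₀}`, then `‖F‖_{T_φ} ≤ Σ_{s ≤ r₀} (s!)⁻¹ ‖D^s f(Pφ)‖ c^s` (the contraction estimate
  [ABKM19] (13.14) for the composition with a gauge-bounded linear map; this is the shape of the
  estimate of the initial perturbation `𝒦(∇φ(x))`, [ABKM19] (12.15)–(12.17));
* **`tayNorm_mono_gauge`** — a WEAKER field gauge gives a STRONGER functional norm: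
  `‖T₂ ξ‖ ≤ ‖T₁ ξ‖ ∀ξ ⇒ ‖F‖^{(T₁)}_{T_φ} ≤ ‖F‖^{(T₂)}_{T_φ}` for `T₂`-local `F` (the mechanism of
  the change-of-scale estimate [ABKM19] Lemma 8.1: `|ξ|_{k+1,X} ≤ |ξ|_{k,X}` gives
  `|F|_{k,X,T_φ} ≤ |F|_{k+1,X,T_φ}`);
* `norm_iteratedFDeriv_apply_le`, `norm_iteratedFDeriv_apply_le_tayNorm` — the duality bound
  `‖D^s F(φ)(ξ_1,…,ξ_s)‖ ≤ ‖D^s F̄(Tφ)‖ ∏_i ‖T ξ_i‖ ≤ s!·‖F‖_{T_φ}·∏_i ‖T ξ_i‖` for local `F`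
  ([ABKM19] (6.45)–(6.46): the norm is defined by exactly this duality).

Everything is proved; no named fact.

## References
* S. Adams, S. Buchholz, R. Kotecký, S. Müller, arXiv:1910.13564, Ch. 6.4, Ch. 8.1, App. A (= Ch. 13)
  [AdamsBuchholzKoteckyMuller2019].
-/

noncomputable section

namespace Literature.MathematicalPhysics.StatisticalMechanics.GradientRG

open scoped BigOperators
open Finset

variable {E V : Type*} [NormedAddCommGroup E] [NormedSpace ℝ E] [FiniteDimensional ℝ E]
  [NormedAddCommGroup V] [NormedSpace ℝ V]
  {𝔸 : Type*} [NormedRing 𝔸] [NormedAlgebra ℝ 𝔸]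

/-! ## The working estimate: functionals factoring through a `T`-bounded linear map -/

/-- **Pull-back estimate** (the contraction estimate [ABKM19] (13.14) for the composition with a
linear map bounded by the gauge): if `F = f ∘ P` with `P : E →ₗ U` linear, `‖P ξ‖ ≤ c ‖T ξ‖` for all
`ξ` (`c ≥ 0`) and `f ∈ C^{r₀}`, then
`‖F‖_{T_φ} ≤ Σ_{s ≤ r₀} (s!)⁻¹ ‖D^s f (P φ)‖ c^s`.
This is how every concrete norm is computed (e.g. the initial perturbation `𝒦(∇φ(x))`,
[ABKM19] (12.15)–(12.17)). [cite: AdamsBuchholzKoteckyMuller2019, Lemma 13.4 (ii) and Lemma 12.3 (proof)] -/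
theorem tayNorm_le_of_factor {U : Type*} [NormedAddCommGroup U] [NormedSpace ℝ U]
    (T : E →ₗ[ℝ] V) (P : E →ₗ[ℝ] U) {c : ℝ} (hc : 0 ≤ c) (hP : ∀ ξ, ‖P ξ‖ ≤ c * ‖T ξ‖)
    {r₀ : ℕ} {f : U → 𝔸} (hf : ContDiff ℝ r₀ f) {F : E → 𝔸} (hF : ∀ φ, F φ = f (P φ)) (φ : E) :
    tayNorm T r₀ F φ ≤
      ∑ s ∈ Finset.range (r₀ + 1), ((s.factorial : ℝ)⁻¹) * (‖iteratedFDeriv ℝ s f (P φ)‖ * c ^ s) := by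
  -- the induced continuous linear map `Q : range T → U`, `Q = P ∘ σ`, has operator norm `≤ c`
  let Q : LinearMap.range T →L[ℝ] U :=
    LinearMap.toContinuousLinearMap (P ∘ₗ gaugeSection T)
  have hQapply : ∀ w : LinearMap.range T, Q w = P (gaugeSection T w) := fun w => rfl
  have hQnorm : ‖Q‖ ≤ c := by
    refine ContinuousLinearMap.opNorm_le_bound _ hc fun w => ?_
    rw [hQapply]
    refine (hP _).trans ?_
    rw [apply_gaugeSection]
    rfl
  -- `gaugeLift T F = f ∘ Q` and `Q (Tφ) = P φ`
  have hlift : gaugeLift T F = f ∘ Q := by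
    funext w
    rw [gaugeLift_apply, hF, Function.comp_apply, hQapply]
  have hQφ : Q (T.rangeRestrict φ) = P φ := by
    rw [hQapply, ← sub_eq_zero, ← map_sub]
    have h0 := hP (gaugeSection T (T.rangeRestrict φ) - φ)
    rw [map_sub T, apply_gaugeSection, show ((T.rangeRestrict φ : LinearMap.range T) : V) = T φ
      from rfl, sub_self, norm_zero, mul_zero] at h0
    exact norm_le_zero_iff.1 h0
  unfold tayNorm
  refine Finset.sum_le_sum fun s hs => ?_
  have hs' : (s : WithTop ℕ∞) ≤ r₀ := by
    exact_mod_cast Nat.lt_succ_iff.1 (Finset.mem_range.1 hs)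
  refine mul_le_mul_of_nonneg_left ?_ (inv_nonneg.2 (Nat.cast_nonneg _))
  rw [hlift, Q.iteratedFDeriv_comp_right hf _ hs', hQφ]
  refine (ContinuousMultilinearMap.norm_compContinuousLinearMap_le _ _).trans ?_
  refine mul_le_mul_of_nonneg_left ?_ (norm_nonneg _)
  rw [Finset.prod_const, Finset.card_univ, Fintype.card_fin]
  exact pow_le_pow_left₀ (norm_nonneg _) hQnorm s

/-- **Monotonicity in the gauge** (a WEAKER field gauge gives a STRONGER functional norm): if
`‖T₂ ξ‖ ≤ ‖T₁ ξ‖` for all `ξ` and `F` is `T₂`-local and `C^{r₀}`, then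
`‖F‖_{T_φ}^{(T₁)} ≤ ‖F‖_{T_φ}^{(T₂)}` — the mechanism behind [ABKM19] Lemma 8.1 /(8.5)
(`|ξ|_{k+1,X} ≤ |ξ|_{k,X}` ⇒ `|F|_{k,X,T_φ} ≤ |F|_{k+1,X,T_φ}`).
[cite: AdamsBuchholzKoteckyMuller2019, Lemma 8.1] -/
theorem tayNorm_mono_gauge {V₂ : Type*} [NormedAddCommGroup V₂] [NormedSpace ℝ V₂]
    (T₁ : E →ₗ[ℝ] V) (T₂ : E →ₗ[ℝ] V₂)
    (h : ∀ ξ, ‖T₂ ξ‖ ≤ ‖T₁ ξ‖) {r₀ : ℕ} {F : E → 𝔸} (hF : ContDiff ℝ r₀ F)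
    (hloc : IsGaugeLocal T₂ F) (φ : E) :
    tayNorm T₁ r₀ F φ ≤ tayNorm T₂ r₀ F φ := by
  have hP : ∀ ξ, ‖T₂.rangeRestrict ξ‖ ≤ 1 * ‖T₁ ξ‖ := fun ξ => by
    rw [one_mul]; exact h ξ
  have hfac : ∀ ψ, F ψ = gaugeLift T₂ F (T₂.rangeRestrict ψ) := fun ψ =>
    (gaugeLift_rangeRestrict hloc ψ).symm
  refine (tayNorm_le_of_factor T₁ T₂.rangeRestrict zero_le_one hP
    (contDiff_gaugeLift T₂ hF) hfac φ).trans (le_of_eq ?_)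
  unfold tayNorm
  refine Finset.sum_congr rfl fun s _ => ?_
  rw [one_pow, mul_one]

/-- **Duality bound for local functionals**: the `s`-th derivative of a `T`-local `C^{r₀}`
functional in directions `ξ_1, …, ξ_s ∈ E` is controlled by the gauge,
`‖D^s F(φ)(ξ_1,…,ξ_s)‖ ≤ ‖D^s F̄(Tφ)‖ ∏_i ‖T ξ_i‖` (`F̄ = gaugeLift T F`), hence by
`s! ‖F‖_{T_φ} ∏_i ‖T ξ_i‖` ([ABKM19] (6.45)–(6.46): the norm is defined by this duality).
[cite: AdamsBuchholzKoteckyMuller2019, Ch. 6.4 (6.45)–(6.46)] -/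
theorem norm_iteratedFDeriv_apply_le {T : E →ₗ[ℝ] V} {r₀ : ℕ} {F : E → 𝔸} (hF : ContDiff ℝ r₀ F)
    (hloc : IsGaugeLocal T F) (φ : E) {s : ℕ} (hs : s ≤ r₀) (ξ : Fin s → E) :
    ‖iteratedFDeriv ℝ s F φ ξ‖ ≤
      ‖iteratedFDeriv ℝ s (gaugeLift T F) (T.rangeRestrict φ)‖ * ∏ i, ‖T (ξ i)‖ := by
  have hs' : (s : WithTop ℕ∞) ≤ r₀ := by exact_mod_cast hs
  have heq : iteratedFDeriv ℝ s F φ =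
      (iteratedFDeriv ℝ s (gaugeLift T F) (gaugeRestrictCLM T φ)).compContinuousLinearMap
        fun _ => gaugeRestrictCLM T := by
    conv_lhs => rw [eq_gaugeLift_comp hloc]
    exact (gaugeRestrictCLM T).iteratedFDeriv_comp_right (contDiff_gaugeLift T hF) φ hs'
  rw [heq, ContinuousMultilinearMap.compContinuousLinearMap_apply]
  refine (ContinuousMultilinearMap.le_opNorm _ _).trans (le_of_eq ?_)
  rfl

/-- The same duality bound against the full Taylor norm:
`‖D^s F(φ)(ξ_1,…,ξ_s)‖ ≤ s! · ‖F‖_{T_φ} · ∏_i ‖T ξ_i‖` for `s ≤ r₀`.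
[cite: AdamsBuchholzKoteckyMuller2019, Ch. 6.4 (6.45)–(6.46)] -/
theorem norm_iteratedFDeriv_apply_le_tayNorm {T : E →ₗ[ℝ] V} {r₀ : ℕ} {F : E → 𝔸}
    (hF : ContDiff ℝ r₀ F) (hloc : IsGaugeLocal T F) (φ : E) {s : ℕ} (hs : s ≤ r₀)
    (ξ : Fin s → E) :
    ‖iteratedFDeriv ℝ s F φ ξ‖ ≤ (s.factorial : ℝ) * tayNorm T r₀ F φ * ∏ i, ‖T (ξ i)‖ := by
  refine (norm_iteratedFDeriv_apply_le hF hloc φ hs ξ).trans ?_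
  refine mul_le_mul_of_nonneg_right ?_ (Finset.prod_nonneg fun _ _ => norm_nonneg _)
  -- the `s`-th term of the sum is at most the sum
  have hmem : s ∈ Finset.range (r₀ + 1) := Finset.mem_range.2 (Nat.lt_succ_of_le hs)
  have hle : ((s.factorial : ℝ)⁻¹) * ‖iteratedFDeriv ℝ s (gaugeLift T F) (T.rangeRestrict φ)‖ ≤
      tayNorm T r₀ F φ := by
    unfold tayNorm
    exact Finset.single_le_sum (f := fun s => ((s.factorial : ℝ)⁻¹) *
      ‖iteratedFDeriv ℝ s (gaugeLift T F) (T.rangeRestrict φ)‖)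
      (fun _ _ => mul_nonneg (inv_nonneg.2 (Nat.cast_nonneg _)) (norm_nonneg _)) hmem
  have hfac : (0 : ℝ) < s.factorial := by positivity
  calc ‖iteratedFDeriv ℝ s (gaugeLift T F) (T.rangeRestrict φ)‖
      = (s.factorial : ℝ) * (((s.factorial : ℝ)⁻¹) *
          ‖iteratedFDeriv ℝ s (gaugeLift T F) (T.rangeRestrict φ)‖) := by
        rw [← mul_assoc, mul_inv_cancel₀ hfac.ne', one_mul]
    _ ≤ (s.factorial : ℝ) * tayNorm T r₀ F φ := mul_le_mul_of_nonneg_left hle hfac.le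

end Literature.MathematicalPhysics.StatisticalMechanics.GradientRG

end
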